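/- Width seat `ym-line-sfw-p2-w5` (prover-ym-line-sfw-p2-w5-g18-0), free hands on planner ym-idea-2 g16's LINE-19 task board (STUB-PLAN-S4b §10,
toward the FREE item T5 = the S4b assembly; crux `AllWindowsColdBox.BoxHighWindowsSU22` = stmt-QuantumFields-24004 / 24335, stub S4b):
the a-priori (Stage I) regime of the bootstrap — link defects, the hemisphere condition of T3, and the smallness arithmetic of the premise. -/
import Summits.QuantumFields.YangMills.Theorems.AllWindowsColdBoxBoxHighLineLandauMinimiser
import Summits.QuantumFields.YangMills.Theorems.AllWindowsColdBoxBoxHighLineImVecSqLeCost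

/-!
# LINE-19 S4b §10, bricks of the assembly T5: link defect ↔ su(2)-coordinates, the hemisphere, and the smallness of the premise

For the one-step bootstrap (STUB-PLAN-S4b §10 T5) on `LandauBootstrapBound` (premise `s·H⁴(1+log H)² ≤ c₀`):

* `linkDefect_eq` : `linkDefect U e = 2 − Re tr (U e)`; `sum_imVec_sq_le_linkDefect` : `Σ_c imVec(U e)_c² ≤ linkDefect U e`
  (✓`imVecSqLeCost`); `imVec_sq_le_linkDefect`, `abs_imVec_le_of_linkDefect_le_sq` : `|imVec(U e)_c| ≤ m` whenever `linkDefect ≤ m²`, `m ≥ 0`;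
* `half_le_re_of_linkDefect_le_one` : `linkDefect U e ≤ 1 ⇒ Re (U e)₀₀ ≥ 1/2` — the hemisphere hypothesis of T3 ✓`quaternionBCH`;
  `linkDefect_le_six_mul_sq` : conversely on the hemisphere `linkDefect ≤ 2·Σ_c imVec² ≤ 6·M²` if all `|imVec_c| ≤ M` (✓`half_cost_le_sum_imVec_sq`);
* `pow_four_mul_le_of_premise` : `s·H⁴(1+log H)² ≤ c₀`, `H ≥ 1`, `s ≥ 0` ⇒ `s·H⁴ ≤ c₀` and `s ≤ c₀`;
  `stageI_defect_le_one` : with `c₀ ≤ 1/270` the Stage-I bound `72900·H⁸·s²` is `≤ 1` — so every box link of the Stage-I Landau representative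
  (✓`exists_landau_inGaugeBall`) lies in the hemisphere, `exists_landau_hemisphere`.

Everything proved; no definition; standard axioms.  HONEST LABEL: helpers toward ONE registered stub (S4b) of a critic-PASSed line on the R2ξ″
RECORD-rung crux 24004 / 24335; no stub is proved by name, no crux, rung or summit is proved; the Yang–Mills mass gap is NOT proved by this file.
-/

set_option autoImplicit false

noncomputable section

open Matrix
open Literature.MathematicalPhysics.QuantumFieldTheory hiding boxEdges
open Literature.MathematicalPhysics.QuantumFieldTheory.LatticeMaxwell
open Literature.MathematicalPhysics.QuantumFieldTheory.AxialGauge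
open Summit.QuantumFields.YangMills.Theorems.WeakCouplingRates
open Literature.Probability.LatticeModels (Site)
open Literature.MathematicalPhysics.QuantumLattice (LGConfig)

namespace Summit.QuantumFields.YangMills.Theorems.AllWindowsColdBoxBoxHighLine

/-! ## Link defect versus su(2)-coordinates -/

/-- `linkDefect U e = 2 − Re tr (U e)`. -/
theorem linkDefect_eq (U : LGConfig 4 SU2) (e : Literature.MathematicalPhysics.QuantumLattice.ZdEdge 4) :
    linkDefect U e = 2 - (((U e : SU2) : Matrix (Fin 2) (Fin 2) ℂ).trace).re := rfl

/-- `Σ_c imVec(U e)_c² ≤ linkDefect U e`. -/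
theorem sum_imVec_sq_le_linkDefect (U : LGConfig 4 SU2) (e : Literature.MathematicalPhysics.QuantumLattice.ZdEdge 4) :
    ∑ c : Fin 3, imVec (U e) c ^ 2 ≤ linkDefect U e := by
  rw [linkDefect_eq]
  exact imVecSqLeCost (U e)

/-- Each su(2)-coordinate squared is at most the link defect. -/
theorem imVec_sq_le_linkDefect (U : LGConfig 4 SU2) (e : Literature.MathematicalPhysics.QuantumLattice.ZdEdge 4) (c : Fin 3) :
    imVec (U e) c ^ 2 ≤ linkDefect U e :=
  (Finset.single_le_sum (f := fun c' => imVec (U e) c' ^ 2) (fun _ _ => sq_nonneg _) (Finset.mem_univ c)).trans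
    (sum_imVec_sq_le_linkDefect U e)

/-- `linkDefect U e ≤ m²` with `m ≥ 0` gives `|imVec(U e)_c| ≤ m`. -/
theorem abs_imVec_le_of_linkDefect_le_sq (U : LGConfig 4 SU2) (e : Literature.MathematicalPhysics.QuantumLattice.ZdEdge 4) (c : Fin 3)
    {m : ℝ} (hm : 0 ≤ m) (h : linkDefect U e ≤ m ^ 2) : |imVec (U e) c| ≤ m := by
  have h1 := (imVec_sq_le_linkDefect U e c).trans h
  exact abs_le_of_sq_le_sq' h1 hm |>.2 |> fun h2 => abs_le.2 ⟨(abs_le_of_sq_le_sq' h1 hm).1, h2⟩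

/-- **The hemisphere**: `linkDefect U e ≤ 1 ⇒ Re (U e)₀₀ ≥ 1/2` (the hypothesis of T3 `quaternionBCH`). -/
theorem half_le_re_of_linkDefect_le_one (U : LGConfig 4 SU2) (e : Literature.MathematicalPhysics.QuantumLattice.ZdEdge 4)
    (h : linkDefect U e ≤ 1) : (1 : ℝ) / 2 ≤ (((U e : SU2) : Matrix (Fin 2) (Fin 2) ℂ) 0 0).re := by
  rw [linkDefect_eq, trace_re_eq] at h
  linarith

/-- Conversely, on the hemisphere the defect is controlled by the su(2)-coordinates: `linkDefect ≤ 6·M²` if all `|imVec_c| ≤ M`. -/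
theorem linkDefect_le_six_mul_sq (U : LGConfig 4 SU2) (e : Literature.MathematicalPhysics.QuantumLattice.ZdEdge 4)
    (hre : 0 ≤ (((U e : SU2) : Matrix (Fin 2) (Fin 2) ℂ) 0 0).re) {M : ℝ} (hM : ∀ c : Fin 3, |imVec (U e) c| ≤ M) :
    linkDefect U e ≤ 6 * M ^ 2 := by
  have h := half_cost_le_sum_imVec_sq (U e) hre
  rw [linkDefect_eq]
  have hc : ∀ c : Fin 3, imVec (U e) c ^ 2 ≤ M ^ 2 := fun c => by
    rw [← sq_abs]; exact pow_le_pow_left₀ (abs_nonneg _) (hM c) 2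
  have h3 : ∑ c : Fin 3, imVec (U e) c ^ 2 ≤ 3 * M ^ 2 := by
    rw [Fin.sum_univ_three]; linarith [hc 0, hc 1, hc 2]
  linarith

/-! ## The smallness arithmetic of the premise `s·H⁴(1+log H)² ≤ c₀` -/

/-- From the premise: `s·H⁴ ≤ c₀` and `s ≤ c₀`. -/
theorem pow_four_mul_le_of_premise {H : ℕ} (hH : 1 ≤ H) {s c₀ : ℝ} (hs : 0 ≤ s)
    (h : s * (H : ℝ) ^ 4 * (1 + Real.log H) ^ 2 ≤ c₀) : s * (H : ℝ) ^ 4 ≤ c₀ ∧ s ≤ c₀ := by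
  have hH1 : (1 : ℝ) ≤ H := by exact_mod_cast hH
  have hL : 1 ≤ (1 + Real.log (H : ℝ)) ^ 2 := by
    have := Real.log_nonneg hH1
    nlinarith
  have hH4 : 1 ≤ (H : ℝ) ^ 4 := one_le_pow₀ hH1
  have h0 : 0 ≤ s * (H : ℝ) ^ 4 := by positivity
  have h1 : s * (H : ℝ) ^ 4 ≤ c₀ := by nlinarith
  exact ⟨h1, by nlinarith⟩

/-- **The Stage-I defect is `≤ 1` in the regime of the premise** (`c₀ ≤ 1/270`): `72900·H⁸·s² ≤ 1`. -/
theorem stageI_defect_le_one {H : ℕ} (hH : 1 ≤ H) {s c₀ : ℝ} (hs : 0 ≤ s) (hc₀ : c₀ ≤ 1 / 270)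
    (h : s * (H : ℝ) ^ 4 * (1 + Real.log H) ^ 2 ≤ c₀) : 72900 * (H : ℝ) ^ 8 * s ^ 2 ≤ 1 := by
  have h1 := (pow_four_mul_le_of_premise hH hs h).1
  have h0 : 0 ≤ s * (H : ℝ) ^ 4 := by positivity
  have h2 : s * (H : ℝ) ^ 4 ≤ 1 / 270 := h1.trans hc₀
  have h3 : (s * (H : ℝ) ^ 4) ^ 2 ≤ (1 / 270) ^ 2 := pow_le_pow_left₀ h0 h2 2
  nlinarith

/-- **Stage I in the hemisphere**: under the premise with `c₀ ≤ 1/270`, the Stage-I Landau representative has every box link of defect `≤ 1`,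
hence in the hemisphere `Re ≥ 1/2` where T3 applies. -/
theorem exists_landau_hemisphere {H : ℕ} (hH : 1 ≤ H) {s c₀ : ℝ} (hs : 0 ≤ s) (hc₀ : c₀ ≤ 1 / 270)
    (h : s * (H : ℝ) ^ 4 * (1 + Real.log H) ^ 2 ≤ c₀) {U : LGConfig 4 SU2} (hW : ColdWall H U) (hS : SmallPlaquettes H s U) :
    ∃ g : Site 4 → SU2, IsInteriorGauge H g ∧
      InLandauGauge H (Literature.MathematicalPhysics.QuantumLattice.gaugeTransformZd g U) ∧
      (∀ e ∈ boxEdges 4 (2 * H + 1),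
        linkDefect (Literature.MathematicalPhysics.QuantumLattice.gaugeTransformZd g U) e ≤ 72900 * (H : ℝ) ^ 8 * s ^ 2) ∧
      ∀ e ∈ boxEdges 4 (2 * H + 1),
        (1 : ℝ) / 2 ≤ (((Literature.MathematicalPhysics.QuantumLattice.gaugeTransformZd g U e : SU2) : Matrix (Fin 2) (Fin 2) ℂ) 0 0).re := by
  obtain ⟨g, hg, hL, hdef⟩ := exists_landau_inGaugeBall hH hs hW hS
  have h1 := stageI_defect_le_one hH hs hc₀ h
  exact ⟨g, hg, hL, hdef, fun e he => half_le_re_of_linkDefect_le_one _ e ((hdef e he).trans h1)⟩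

end Summit.QuantumFields.YangMills.Theorems.AllWindowsColdBoxBoxHighLine

end
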